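import Summits.HodgeConjecture.HodgeConjecture.Theorems.F0P6aDatumOfInputsDefs
import Summits.HodgeConjecture.HodgeConjecture.Theorems.F0P6aStubDOWN
import Summits.HodgeConjecture.HodgeConjecture.Theorems.F0P6aStubFROB
import HarnessLib

/-!
## Import provenance (CANONICAL HEADER — LEAD F0P6-plan (g6) «M-142a» (A): bare `import` lines only; their provenance notes, verbatim)

- `import Summits.HodgeConjecture.HodgeConjecture.Theorems.F0P6aDatumOfInputsDefs` -- ★ DEFS SIDE of `Lines/F0_P6a_DatumOfInputs.lean` (PART 4 of 4): the closed socket TYPES `StubDOWNType` ∕ `StubFROBType` ∕ `DatumOfLineType` and the ★-shaped head `datum_of_inputs_star`; parts 1–3 (letters, `section Dock`, `L1Fold` organs with the L1 head `L1Fold.stub_LINES_of_organs`) transitively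
- `import Summits.HodgeConjecture.HodgeConjecture.Theorems.F0P6aStubDOWN` -- ★ L2 leaf head `F0P6aStubDOWN.stub_DOWN_of_organs` (PART 3 of 3; the term that pays the hub socket `stub_DOWN` in ED. 5)
- `import Summits.HodgeConjecture.HodgeConjecture.Theorems.F0P6aStubFROB` -- ★ L3 leaf head `F0P6aStubFROB.stubFROB_of_parts` (PART 3 of 3; the term that pays the hub socket `stub_FROB` in ED. 5)

# `F0P6aDatumOfLine` — ★ CAPSTONE of the D-LINE of `Cruxes/HLiu418` (MOD programme P6a, Rows 1–3∕6): the DATUM OF THE LINE as a `Theorems/` theorem.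

`datum_of_line_star : DatumOfLineType` — the closed `Prop` `DatumOfLineType` (★ `Theorems/F0P6aDatumOfInputsDefs.lean` :138; = the statement of the hub head
`Lines/F0_P6a_DatumOfInputs.lean` `datum_of_line` :270–:297 and of the spine socket `stub_DATUM`, TOKEN FOR TOKEN) is INHABITED, by the ★ head `datum_of_inputs_star` at the three
★ leaf heads `L1Fold.stub_LINES_of_organs` (L1), `F0P6aStubDOWN.stub_DOWN_of_organs` (L2), `F0P6aStubFROB.stubFROB_of_parts` (L3) — one application, no new mathematics; axioms
{propext, Classical.choice, Quot.sound}.  It is the ★ image of the hub՚s ED. 5 «(P) SOCKETS PAID BY ★ TERM» state (tree sha16 0817d8a98b7d55c8, commit 77d70f378cda, olean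
a8efe34d573314eb s0; there `datum_of_line := … stub_LINES I … stub_DOWN I 𝔡 … stub_FROB I 𝔡 …` with the three sockets paid by exactly these ★ terms), so that the D-LINE՚s conclusion no
longer lives only in a `Cruxes/…/Lines` workfile.  The kernel-checked `example` below re-states the hub head՚s ∀-statement VERBATIM (hub :270–:297) and closes it by `datum_of_line_star`:
`DatumOfLineType` IS that statement, token for token.  NAME: `datum_of_line_star` (not `datum_of_line`) so that this module and the hub can sit in ONE environment (NO-CROSS-IMPORT
rule «M-142f» is therefore moot: no fully-qualified name of the hub is re-declared here; the hub and its importers `Lines/F0_P6a_StubFROB.lean` ∕ `Lines/F0_P6a_StubLINES.lean` are untouched).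
Namespace `Summit.HodgeConjecture.HodgeConjecture.Cruxes.HLiu418.F0P6aDatumOfInputs` (= the hub՚s and ★ Defs՚, BY DESIGN D-0017).
HONEST LABEL: HC_CM is proved only modulo the 7 printed citations (2 remaining named inputs hLiu418 = stmt-HodgeConjecture-24832, h413 = stmt-HodgeConjecture-24833) until rung 0
closes; this file is count-neutral (no registry touched: 24832 ← `Lines/d6_cm_curve.lean` v3 {1: `stub_letter_A₂P_hodgeFree`}; 27458 ∅; in no registered cone).
-/

set_option autoImplicit false

namespace Summit.HodgeConjecture.HodgeConjecture.Cruxes.HLiu418.F0P6aDatumOfInputs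

set_option linter.dupNamespace false  -- `Summit.HodgeConjecture.HodgeConjecture.…` BY DESIGN (D-0017)

open CategoryTheory CategoryTheory.Limits NumberField IsDedekindDomain MulAction
open scoped Matrix Polynomial Pointwise MonoidalCategory
open Literature.NumberTheory.GaloisRepresentations
open Literature.NumberTheory.Automorphic Literature.NumberTheory.Automorphic.UnitaryGroup
open Literature.AlgebraicGeometry.ShimuraVarieties.UnitaryCanonicalModel
open Literature.NumberTheory.Automorphic.Liu2021.AppendixC
open Literature.AlgebraicGeometry.Motives (AlgPoints IntegralModel SchemeOver thickening thickeningGalAction thickeningLift specOver relFrobeniusOver frobeniusTwistOver)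
open Literature.NumberTheory.DiophantineGeometry (geomResidueField specialFibreFunctor specResidueField)
open Literature.AlgebraicGeometry.RelativeSpec (ActionOver)
open Literature.NumberTheory.EllipticCurves (genericFibre)
open Literature.AlgebraicGeometry.GroupSchemes.AffineGroupScheme (Alg quotIncl)
open Summit.HodgeConjecture.HodgeConjecture.Cruxes.HLiu418.F0P6cDictConstructors (kerFI AdmSub IdealIsEtale isAdm_kerFI)
open Summit.HodgeConjecture.HodgeConjecture.Cruxes.HLiu418.F0P6aModuliDatumDefs
open Summit.HodgeConjecture.HodgeConjecture.Cruxes.HLiu418.F0P6aRGDAssembly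

set_option maxHeartbeats 400000 in
/-- **★ D-LINE DATUM `datum_of_line_star`** — `DatumOfLineType` (the statement of the hub head `datum_of_line` ∕ the spine socket `stub_DATUM`, token for token: at MH՚s inner
binders, from the localised PEL inputs `I : RGDInputsAt …` the moduli datum `ModuliDatum …` is inhabited) holds: the ★ head `datum_of_inputs_star` (assembly — tuple, scalars and
`inj₀` copied from `I`; the dock by one choice; carriers by construction; generic readings + `hecke` from the L1 hypothesis; the downstairs readings and their laws from the L2
hypothesis; the normalised twist data, co-ideals and the Frobenius cover ∕ roof from the L3 hypothesis) applied to the three ★ leaf heads `L1Fold.stub_LINES_of_organs`,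
`F0P6aStubDOWN.stub_DOWN_of_organs`, `F0P6aStubFROB.stubFROB_of_parts` (their types ARE the socket types `type_of% @L1Fold.stub_LINES_of_organs` ∕ `StubDOWNType` ∕ `StubFROBType`,
binder for binder — the hub՚s ED. 4 ORDER CERTIFICATES and the leaf junctions).
[cite: Liu2021, Prop. D.8 p. 135, pp. 136–138] [cite: RapoportSmithlingZhang2020Diagonal, §4.1 Thm. 4.1 p. 17] [cite: Kottwitz1992, §5 pp. 389–391] -/
theorem datum_of_line_star : DatumOfLineType :=
  datum_of_inputs_star @L1Fold.stub_LINES_of_organs @F0P6aStubDOWN.stub_DOWN_of_organs @F0P6aStubFROB.stubFROB_of_parts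

set_option maxHeartbeats 400000 in
/-- TOKEN-FOR-TOKEN CERTIFICATE: the hub head՚s ∀-statement (`Lines/F0_P6a_DatumOfInputs.lean` ED. 5 :270–:297, VERBATIM) closed by `datum_of_line_star` — `DatumOfLineType` IS that statement. -/
example : ∀ (F : Type) [Field F] [NumberField F] [IsCMField F] [IsGalois ℚ F] (ι₁ : F →+* ℂ)
    (Jstar : Matrix (Fin 2) (Fin 2) F)
    (K₀ : C5.OpenCompactSubgroup ↥(finAdelic ↥(maximalRealSubfield F) F (IsCMField.complexConj F) 2 Jstar))
    (S : RecordSystemGS F Jstar ι₁ K₀) (hU7ₛ : S.HeckeTranslateDefinedOver)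
    (hJ : (Jstar.map (IsCMField.complexConj F))ᵀ = Jstar) (hJu : IsUnit Jstar)
    (Fi : Type) [Field Fi] [Algebra F Fi] [FiniteDimensional F Fi] [IsGalois F Fi]
    (Kc : C5.SmallLevel K₀) (G : Type) [Group G] [Finite G]
    (𝓜 : IntegralModel (𝓞 F) F ((thickening F Fi).obj (S.M.obj Kc)))
    (w : HeightOneSpectrum (𝓞 F)) (hw : (IsCMField.complexConj F) • w ≠ w) (h𝓨 : (𝓜.localise w).IsSmoothProper 1)
    (θ : ActionOver (𝓜.localise w).total.hom ((Fi ≃ₐ[F] Fi) × G))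
    (_hθ : ∀ γ : Fi ≃ₐ[F] Fi,
       (genericFibre (HeightOneSpectrum.valuationSubringAtPrime F w) F).map
             (Over.isoMk (θ.aut (γ, 1)) (θ.aut_comp (γ, 1))).hom ≫ (𝓜.localise w).genericIso'.hom
         = (𝓜.localise w).genericIso'.hom ≫
             (Over.isoMk ((thickeningGalAction (L := Fi) (S.M.obj Kc)).aut γ)
               ((thickeningGalAction (L := Fi) (S.M.obj Kc)).aut_comp γ)).hom)
    (e : Fi →ₐ[F] AlgebraicClosure (w.adicCompletion F))
    (_hunit : (UnitaryGroup.isUnit_placeForm Jstar hJu w).unit ∈ glInt 2 (w.adicCompletion F))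
    (_hKc : UnitaryGroup.IsHyperspecialAt ↥(maximalRealSubfield F) F (IsCMField.complexConj F) 2 Jstar Kc.1.1
      (w.under (𝓞 ↥(maximalRealSubfield F))))
    (_hdisj : haveI : AlgebraicGeometry.IsProper (𝓜.localise w).total.hom := h𝓨.2
      ∀ (β : Fi ≃ₐ[F] Fi) (P Q : AlgPoints (S.M.obj Kc) (AlgebraicClosure (w.adicCompletion F))),
        (𝓜.localise w).geomReductionMap (thickeningLift e (S.M.obj Kc) P) =
          AlgPoints.map ((specialFibreFunctor w).map (Over.isoMk (θ.aut (β, 1)) (θ.aut_comp (β, 1))).hom :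
              (𝓜.localise w).reductionAt ⟶ (𝓜.localise w).reductionAt)
            ((𝓜.localise w).geomReductionMap (thickeningLift e (S.M.obj Kc) Q)) → β = 1),
    RGDInputsAt F ι₁ Jstar K₀ S hU7ₛ hJ hJu Fi Kc G 𝓜 w hw h𝓨 θ e →
      Nonempty (ModuliDatum F ι₁ Jstar K₀ S hU7ₛ hJ hJu Fi Kc G 𝓜 w hw h𝓨 θ e) :=
  datum_of_line_star

end Summit.HodgeConjecture.HodgeConjecture.Cruxes.HLiu418.F0P6aDatumOfInputs
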